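import Summits.Schanuel.Schanuel.Theorems.RootDecomp1KHyper24

/-!
# RootDecomp1KHyper — lens 6, generation 15 «QUAD-ANCHORED CELL» (QuadAnchor.lean 33b3769e…, 2400 l) — continuation (RootDecomp1KHyper25): §5b the explicit member `y_Q = Σ_k w_k 2^{−a_k}`: `pw`, `yterm`, `yQ`, `pmP`, `pmM`, tails, `hyperQuadApprox_yQ`, `sb_three_yQ`, `hyperLinLiouville_yQ`, `linearIndependent_yQ`

(lens-6 g15 `QuadAnchor.lean`, sha256 33b3769e…6b415, farm rc 0 · 0 sorry · axioms standard; port by census-1 gen 14 in eight parts RootDecomp1KHyper20–27 at the section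
cuts of CENSUS-REQUEST 2026-08-31T01:16:56Z (STATUS L1528; §5 cut at §5b; §3's three engine corollaries moved to where they are first used); each part imports the
previous; statements and proofs verbatim (54 one-line docstrings added, six generic one-liners privatised with per-part private copies, the two `linter.*` options dropped, two unused binders renamed `_`); `hLW : LWMeasure` (tree-proved
named fact) stays a binder where marked; `--supports stmt-Schanuel-33363` (A₄ʰ HyperLiouvilleSchanuel, residual of record `Rank3SpanResidual`). Nothing here proves Schanuel; rung 0.)
-/

noncomputable section

open Complex IntermediateField Polynomial

namespace Summit.Schanuel.Schanuel.Theorems.RootDecomp1KHyper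

namespace HyperCell
variable {n : ℕ}
open Summit.Schanuel.Schanuel.Theorems.RootDecomp1KGeneric (HasHLPairInSpan Rank3SpanResidual
  mem_adjoin_of_mem_span cexp_mem_adjoin_of_mem_span)

/-! ### 5b. An explicit member: `y_Q = Σ_k w_k · 2^{−a_k}`, `w_k = 1` (`k` even), `√2` (`k` odd)

Here `a_k = hexp k` (`a₀ = 1`, `a_{k+1} = 2^{(k+1) a_k}`, the tree's super-lacunary exponents).  The
partial sums are `(P_K + M_K √2)/2^{a_K}` with natural numbers `P_K, M_K` (recursions `pmP`, `pmM`),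
the tail after `K` terms lies in `(0, 2√2 · 2^{−a_K}]`, and `y_Q` is hyper-approximable from `ℚ(√2)`;
the approximants genuinely MIX the two anchors (`P_K` is odd iff `K` is even, `M_K` is odd iff `K` is
odd), which is what makes the triple `(1, √2, y_Q)` ternary rather than a disguised pair. -/

/-- `1 ≤ √2`. -/
private theorem one_le_sqrt_two : (1 : ℝ) ≤ Real.sqrt 2 := by
  have h := Real.sqrt_le_sqrt (show (1 : ℝ) ≤ 2 by norm_num)
  rwa [Real.sqrt_one] at h

/-- `√2 ≤ 3/2`. -/
private theorem sqrt_two_le_three_halves : Real.sqrt 2 ≤ 3 / 2 :=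
  (Real.sqrt_le_left (by norm_num)).mpr (by norm_num)

/-- `√2` is irrational, stated for the cast `((2 : ℕ) : ℝ)` that `quadTriple 2` uses. -/
private theorem irrational_sqrt_two' : Irrational (Real.sqrt ((2 : ℕ) : ℝ)) := by
  rw [Nat.cast_ofNat]; exact irrational_sqrt_two

/-- The parity weight. -/
def pw (k : ℕ) : ℝ := if Even k then 1 else Real.sqrt 2

/-- `pw k = 1` for even `k`. -/
theorem pw_of_even {k : ℕ} (hk : Even k) : pw k = 1 := if_pos hk
/-- `pw k = √2` for odd `k`. -/
theorem pw_of_not_even {k : ℕ} (hk : ¬ Even k) : pw k = Real.sqrt 2 := if_neg hk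

/-- `1 ≤ pw k`. -/
theorem one_le_pw (k : ℕ) : 1 ≤ pw k := by
  unfold pw; split_ifs
  · exact le_rfl
  · exact one_le_sqrt_two

/-- `pw k ≤ √2`. -/
theorem pw_le (k : ℕ) : pw k ≤ Real.sqrt 2 := by
  unfold pw; split_ifs
  · exact one_le_sqrt_two
  · exact le_rfl

/-- `pw k` is positive. -/
theorem pw_pos (k : ℕ) : 0 < pw k := lt_of_lt_of_le one_pos (one_le_pw k)

/-- The `k`-th term `w_k 2^{−a_k}`. -/
def yterm (k : ℕ) : ℝ := pw k / (2 : ℝ) ^ hexp k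

/-- Every term `yterm k = pw k / 2^{a_k}` is positive. -/
theorem yterm_pos (k : ℕ) : 0 < yterm k := div_pos (pw_pos k) (by positivity)

/-- `yterm k ≤ √2 / 2^{a_k}`. -/
theorem yterm_le (k : ℕ) : yterm k ≤ Real.sqrt 2 * (1 / (2 : ℝ) ^ hexp k) := by
  rw [yterm, mul_one_div]; exact div_le_div_of_nonneg_right (pw_le k) (by positivity)

/-- `1 / 2^{a_k} ≤ yterm k`. -/
theorem one_div_le_yterm (k : ℕ) : 1 / (2 : ℝ) ^ hexp k ≤ yterm k :=
  div_le_div_of_nonneg_right (one_le_pw k) (by positivity)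

/-- The series `Σ yterm k` defining `y_Q` is summable. -/
theorem summable_yterm : Summable yterm :=
  Summable.of_nonneg_of_le (fun k => (yterm_pos k).le) yterm_le (summable_lambdaH.mul_left _)

/-- **The explicit number `y_Q`.** -/
def yQ : ℝ := ∑' k, yterm k

/-- Numerators of the partial sums: rational part. -/
def pmP : ℕ → ℕ
  | 0 => 1
  | K + 1 => pmP K * 2 ^ (hexp (K + 1) - hexp K) + if Even (K + 1) then 1 else 0

/-- Numerators of the partial sums: `√2` part. -/
def pmM : ℕ → ℕ
  | 0 => 0
  | K + 1 => pmM K * 2 ^ (hexp (K + 1) - hexp K) + if Even (K + 1) then 0 else 1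

/-- `2^{a_{K+1}} = 2^{a_K} · 2^{a_{K+1} − a_K}` (as real numbers). -/
theorem two_pow_hexp_succ (K : ℕ) :
    (2 : ℝ) ^ hexp (K + 1) = 2 ^ hexp K * 2 ^ (hexp (K + 1) - hexp K) := by
  rw [← pow_add]; congr 1; have := hexp_lt_succ K; omega

/-- **Partial sums**: `Σ_{k ≤ K} w_k 2^{−a_k} = (P_K + M_K √2)/2^{a_K}`. -/
theorem partialSum_yterm (K : ℕ) :
    ∑ k ∈ Finset.range (K + 1), yterm k = ((pmP K : ℝ) + (pmM K : ℝ) * Real.sqrt 2) / (2 : ℝ) ^ hexp K := by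
  induction K with
  | zero => simp [yterm, pw, pmP, pmM]
  | succ K ih =>
      rw [Finset.sum_range_succ, ih, yterm, two_pow_hexp_succ K]
      have h2 : (0 : ℝ) < 2 ^ hexp K := by positivity
      have h3 : (0 : ℝ) < 2 ^ (hexp (K + 1) - hexp K) := by positivity
      by_cases hK : Even (K + 1)
      · rw [pw_of_even hK]
        simp only [pmP, pmM, if_pos hK]
        push_cast
        field_simp
        ring
      · rw [pw_of_not_even hK]
        simp only [pmP, pmM, if_neg hK]
        push_cast
        field_simp
        ring

/-- `P_K` is odd iff `K` is even. -/
theorem odd_pmP_iff (K : ℕ) : Odd (pmP K) ↔ Even K := by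
  induction K with
  | zero => decide
  | succ K ih =>
      have hd : hexp (K + 1) - hexp K ≠ 0 := by have := hexp_lt_succ K; omega
      have hev : Even (pmP K * 2 ^ (hexp (K + 1) - hexp K)) :=
        (Nat.even_pow.mpr ⟨even_two, hd⟩).mul_left _
      show Odd (pmP K * 2 ^ (hexp (K + 1) - hexp K) + if Even (K + 1) then 1 else 0) ↔ Even (K + 1)
      by_cases hK : Even (K + 1)
      · rw [if_pos hK]; exact ⟨fun _ => hK, fun _ => hev.add_one⟩
      · rw [if_neg hK, add_zero]
        exact ⟨fun h => absurd hev (Nat.not_even_iff_odd.mpr h), fun h => absurd h hK⟩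

/-- `M_K` is odd iff `K` is odd. -/
theorem odd_pmM_iff (K : ℕ) : Odd (pmM K) ↔ ¬ Even K := by
  induction K with
  | zero => decide
  | succ K ih =>
      have hd : hexp (K + 1) - hexp K ≠ 0 := by have := hexp_lt_succ K; omega
      have hev : Even (pmM K * 2 ^ (hexp (K + 1) - hexp K)) :=
        (Nat.even_pow.mpr ⟨even_two, hd⟩).mul_left _
      show Odd (pmM K * 2 ^ (hexp (K + 1) - hexp K) + if Even (K + 1) then 0 else 1) ↔ ¬ Even (K + 1)
      by_cases hK : Even (K + 1)
      · rw [if_pos hK, add_zero]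
        exact ⟨fun h => absurd hev (Nat.not_even_iff_odd.mpr h), fun h => absurd hK h⟩
      · rw [if_neg hK]; exact ⟨fun _ => hK, fun _ => hev.add_one⟩

/-- `y_Q` is its `K`-th partial sum plus the tail `Σ_{k ≥ K} yterm k`. -/
theorem yQ_eq_partialSum_add_tail (K : ℕ) :
    yQ = ∑ k ∈ Finset.range K, yterm k + ∑' k, yterm (k + K) :=
  (summable_yterm.sum_add_tsum_nat_add K).symm

/-- The tails of `Σ yterm` are summable. -/
theorem summable_yterm_tail (K : ℕ) : Summable fun k => yterm (k + K) :=
  (summable_nat_add_iff K).mpr summable_yterm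

/-- Every tail of `Σ yterm` is positive. -/
theorem yQ_tail_pos (K : ℕ) : 0 < ∑' k, yterm (k + K) :=
  (summable_yterm_tail K).tsum_pos (fun _ => (yterm_pos _).le) 0 (yterm_pos _)

/-- Tail bound: `Σ_{k ≥ K} yterm k ≤ √2 · (2 / 2^{a_K})`. -/
theorem yQ_tail_le (K : ℕ) : ∑' k, yterm (k + K) ≤ Real.sqrt 2 * (2 * (1 / (2 : ℝ) ^ hexp K)) :=
  calc ∑' k, yterm (k + K) ≤ ∑' k, Real.sqrt 2 * (1 / (2 : ℝ) ^ hexp (k + K)) :=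
        Summable.tsum_le_tsum (fun _ => yterm_le _) (summable_yterm_tail K)
          (((summable_nat_add_iff K).mpr summable_lambdaH).mul_left _)
    _ = Real.sqrt 2 * ∑' k, 1 / (2 : ℝ) ^ hexp (k + K) := tsum_mul_left
    _ ≤ Real.sqrt 2 * (2 * (1 / (2 : ℝ) ^ hexp K)) :=
        mul_le_mul_of_nonneg_left (lambdaH_tail_le K) (Real.sqrt_nonneg _)

/-- The `K`-th term is at most the `K`-th tail. -/
theorem yterm_le_tail (K : ℕ) : yterm K ≤ ∑' k, yterm (k + K) := by
  have h := (summable_yterm_tail K).le_tsum 0 (fun j _ => (yterm_pos _).le)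
  simpa using h

/-- The tree's hyper-Liouville constant `λ_H = Σ_k 2^{−a_k}` is at most `1`. -/
theorem lambdaH_le_one : lambdaH ≤ 1 := by
  have h := lambdaH_eq_partialSum_add_tail 0
  have h2 := lambdaH_tail_le 0
  rw [Finset.sum_range_zero, zero_add] at h
  rw [hexp_zero, pow_one] at h2
  linarith

/-- `y_Q ≤ √2`. -/
theorem yQ_le_sqrt_two : yQ ≤ Real.sqrt 2 :=
  calc yQ ≤ ∑' k, Real.sqrt 2 * (1 / (2 : ℝ) ^ hexp k) :=
        Summable.tsum_le_tsum yterm_le summable_yterm (summable_lambdaH.mul_left _)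
    _ = Real.sqrt 2 * lambdaH := by rw [tsum_mul_left]; rfl
    _ ≤ Real.sqrt 2 * 1 := mul_le_mul_of_nonneg_left lambdaH_le_one (Real.sqrt_nonneg _)
    _ = Real.sqrt 2 := mul_one _

/-- Every partial sum of `Σ yterm` is strictly below `y_Q`. -/
theorem partialSum_lt_yQ (K : ℕ) : ∑ k ∈ Finset.range K, yterm k < yQ := by
  rw [yQ_eq_partialSum_add_tail K]; linarith [yQ_tail_pos K]

/-- Size of the numerators: `P_K + M_K ≤ P_K + M_K √2 < 2 · 2^{a_K}`. -/
theorem pmP_add_pmM_le (K : ℕ) : (pmP K : ℝ) + pmM K ≤ 2 * 2 ^ hexp K := by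
  have h1 : ((pmP K : ℝ) + (pmM K : ℝ) * Real.sqrt 2) / (2 : ℝ) ^ hexp K < Real.sqrt 2 := by
    rw [← partialSum_yterm]; exact (partialSum_lt_yQ (K + 1)).trans_le yQ_le_sqrt_two
  have h2 : (0 : ℝ) < 2 ^ hexp K := by positivity
  rw [div_lt_iff₀ h2] at h1
  have h3 : (pmM K : ℝ) ≤ (pmM K : ℝ) * Real.sqrt 2 :=
    le_mul_of_one_le_right (Nat.cast_nonneg _) one_le_sqrt_two
  nlinarith [h1, h3, sqrt_two_le_three_halves, h2]

/-- `e ≤ 3`. -/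
private theorem exp_one_le_three' : Real.exp 1 ≤ 3 := by
  have := Real.exp_one_lt_d9; norm_num at this; linarith

/-- `(1/3)^X ≤ exp(−X)`. -/
private theorem third_pow_le_exp_neg' (X : ℕ) : ((1 : ℝ) / 3) ^ X ≤ Real.exp (-(X : ℝ)) := by
  have h1 : (1 : ℝ) / 3 ≤ Real.exp (-1) := by
    rw [Real.exp_neg, ← one_div]
    exact one_div_le_one_div_of_le (Real.exp_pos 1) exp_one_le_three'
  calc ((1 : ℝ) / 3) ^ X ≤ Real.exp (-1) ^ X := pow_le_pow_left₀ (by norm_num) h1 X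
    _ = Real.exp (-(X : ℝ)) := by rw [← Real.exp_nat_mul]; ring_nf

/-- `3 · 16^{−X} < 3^{−X}` for `X ≥ 1`. -/
private theorem three_mul_sixteenth_pow_lt {X : ℕ} (hX : 1 ≤ X) :
    3 * ((1 : ℝ) / 16) ^ X < ((1 : ℝ) / 3) ^ X := by
  have e : ((1 : ℝ) / 3) ^ X = ((16 : ℝ) / 3) ^ X * ((1 : ℝ) / 16) ^ X := by
    rw [← mul_pow]; norm_num
  rw [e]
  have h : (3 : ℝ) < ((16 : ℝ) / 3) ^ X :=
    calc (3 : ℝ) < 16 / 3 := by norm_num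
      _ ≤ ((16 : ℝ) / 3) ^ X := le_self_pow₀ (by norm_num) (by omega)
  exact mul_lt_mul_of_pos_right h (by positivity)

/-- The level arithmetic: for `K ≥ 3m + 3`, `4 · 2^{m(a_K + 2)} ≤ a_{K+1}`. -/
theorem four_mul_two_pow_le_hexp_succ (m K : ℕ) (hK : 3 * m + 3 ≤ K) :
    4 * 2 ^ (m * (hexp K + 2)) ≤ hexp (K + 1) := by
  rw [hexp_succ, show 4 * 2 ^ (m * (hexp K + 2)) = 2 ^ (m * (hexp K + 2) + 2) by
    rw [pow_add]; ring]
  apply Nat.pow_le_pow_right (by norm_num)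
  have h1 := one_le_hexp K
  have h2 : (3 * m + 4) * hexp K ≤ (K + 1) * hexp K := Nat.mul_le_mul_right _ (by omega)
  have h3 : m * 1 ≤ m * hexp K := Nat.mul_le_mul_left m h1
  nlinarith [h1, h2, h3]

/-- **`y_Q` is hyper-approximable from `ℚ(√2)`** — an explicit, certified witness: the approximant
at level `m` is the partial sum `(P_K + M_K√2)/2^{a_K}`, `K = 3m + 3`. -/
theorem hyperQuadApprox_yQ : HyperQuadApprox 2 yQ := by
  intro m
  obtain ⟨K, hK⟩ : ∃ K : ℕ, K = 3 * m + 3 := ⟨_, rfl⟩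
  have hA1 : 1 ≤ hexp K := one_le_hexp K
  -- the approximant = the partial sum with K+1 terms
  have hβ : (((pmP K : ℤ) : ℝ) + ((pmM K : ℤ) : ℝ) * Real.sqrt ((2 : ℕ) : ℝ)) / ((2 ^ hexp K : ℕ) : ℝ) =
      ∑ k ∈ Finset.range (K + 1), yterm k := by
    rw [partialSum_yterm]; push_cast; ring
  have htail : yQ - ∑ k ∈ Finset.range (K + 1), yterm k = ∑' k, yterm (k + (K + 1)) := by
    rw [yQ_eq_partialSum_add_tail (K + 1)]; ring
  have htpos := yQ_tail_pos (K + 1)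
  refine ⟨(pmP K : ℤ), (pmM K : ℤ), 2 ^ hexp K, by positivity, ?_, ?_⟩
  · rw [hβ]; intro h; rw [← sub_eq_zero, htail] at h; exact htpos.ne' h
  · rw [hβ, htail, abs_of_pos htpos]
    -- height: X = 1 + 2^A + P + M ≤ 2^(A+2); X^m ≤ Y := 2^(m (A+2))
    set Y : ℕ := 2 ^ (m * (hexp K + 2)) with hY
    have hY1 : 1 ≤ Y := Nat.one_le_two_pow
    have hX : (1 + ((2 ^ hexp K : ℕ) : ℝ) + |((pmP K : ℤ) : ℝ)| + |((pmM K : ℤ) : ℝ)|) ^ m ≤ (Y : ℝ) := by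
      have hPM := pmP_add_pmM_le K
      have h2A : (1 : ℝ) ≤ 2 ^ hexp K := one_le_pow₀ (by norm_num)
      have hle : 1 + ((2 ^ hexp K : ℕ) : ℝ) + |((pmP K : ℤ) : ℝ)| + |((pmM K : ℤ) : ℝ)| ≤
          (2 : ℝ) ^ (hexp K + 2) := by
        push_cast
        rw [Nat.abs_cast, Nat.abs_cast, pow_add]
        nlinarith [hPM, h2A]
      calc _ ≤ ((2 : ℝ) ^ (hexp K + 2)) ^ m := pow_le_pow_left₀ (by positivity) hle m
        _ = (Y : ℝ) := by rw [hY]; push_cast; rw [← pow_mul, Nat.mul_comm]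
    -- tail ≤ 2√2/2^(a_{K+1}) ≤ 2√2 · 16^(-Y) < 3^(-Y) ≤ exp(-Y) ≤ exp(-X^m)
    have h4Y : 4 * Y ≤ hexp (K + 1) := by rw [hY]; exact four_mul_two_pow_le_hexp_succ m K (by omega)
    have hcmp : 1 / (2 : ℝ) ^ hexp (K + 1) ≤ 1 / (2 : ℝ) ^ (4 * Y) :=
      one_div_le_one_div_of_le (by positivity) (pow_le_pow_right₀ (by norm_num) h4Y)
    have e16 : (1 : ℝ) / (2 : ℝ) ^ (4 * Y) = ((1 : ℝ) / 16) ^ Y := by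
      rw [pow_mul, one_div_pow]; norm_num
    calc ∑' k, yterm (k + (K + 1)) ≤ Real.sqrt 2 * (2 * (1 / (2 : ℝ) ^ hexp (K + 1))) := yQ_tail_le (K + 1)
      _ ≤ Real.sqrt 2 * (2 * (1 / (2 : ℝ) ^ (4 * Y))) :=
          mul_le_mul_of_nonneg_left (mul_le_mul_of_nonneg_left hcmp (by norm_num)) (Real.sqrt_nonneg _)
      _ = 2 * Real.sqrt 2 * ((1 : ℝ) / 16) ^ Y := by rw [e16]; ring
      _ ≤ 3 * ((1 : ℝ) / 16) ^ Y := by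
          apply mul_le_mul_of_nonneg_right _ (by positivity)
          linarith [sqrt_two_le_three_halves]
      _ < ((1 : ℝ) / 3) ^ Y := three_mul_sixteenth_pow_lt hY1
      _ ≤ Real.exp (-(Y : ℝ)) := third_pow_le_exp_neg' Y
      _ ≤ Real.exp (-((1 + ((2 ^ hexp K : ℕ) : ℝ) + |((pmP K : ℤ) : ℝ)| + |((pmM K : ℤ) : ℝ)|) ^ m)) :=
          Real.exp_le_exp.mpr (neg_le_neg hX)

/-- **THE EXPLICIT MEMBER (mod the LW measure): `trdeg ℚ(√2, y_Q, e, e^{√2}, e^{y_Q}) ≥ 3`**, i.e.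
Schanuel's bound for the explicit ℚ-free `HyperLinLiouville` triple `(1, √2, y_Q)`. -/
theorem sb_three_yQ (hLW : LWMeasure) : SB 3 (quadTriple 2 yQ) :=
  sb_three_quadTriple hLW irrational_sqrt_two' hyperQuadApprox_yQ

/-- The explicit triple `z_Q = (1, √2, y_Q)` is hyper-Liouville as a linear form. -/
theorem hyperLinLiouville_yQ : HyperLinLiouville (quadTriple 2 yQ) :=
  hyperLinLiouville_quadTriple hyperQuadApprox_yQ

/-- The explicit triple `z_Q = (1, √2, y_Q)` is `ℚ`-linearly independent. -/
theorem linearIndependent_yQ : LinearIndependent ℚ (quadTriple 2 yQ) :=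
  linearIndependent_quadTriple irrational_sqrt_two' hyperQuadApprox_yQ

end HyperCell

end Summit.Schanuel.Schanuel.Theorems.RootDecomp1KHyper
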